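import Mathlib
import Literature.NumberTheory.Transcendental.CurvePeriods
import Literature.NumberTheory.Transcendental.CurvePeriodsGmLoopsProofs

/-!
# crux-triage r1 (triager 2) — stmt-KontsevichZagierPeriods-14055 — evidence for the `kleinian-sigma-presentation` block

The card's first lemma `SketchIdeator1.kleinianSigma_genusTwo` takes
`(hV : (curveV lam).IsSmoothAffineCurve)` as its ONLY geometric hypothesis. This file proves that
hypothesis at the DEGENERATE parameter `lam = 0` (`f = 4x⁵`: the cuspidal RATIONAL curve
`y² = 4x⁵` with the cusp removed by `w·y = 1`): `curveV_zero_smooth`. So the lemma's hypotheses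
are satisfiable at `lam = 0`, where its conclusion is false (paper argument in TRIAGE-r1-2.md: the
curve is one `𝔾ₘ`-orbit `s ↦ (s² x, s⁵ y, s⁻⁵ w)` — `orbit_mem` below —, `du₁ = w dx`,
`du₂ = x w dx` are exact on it, and no entire `σ` has `℘₂₂ = −∂₂∂₂ log σ` both periodic for a
rank-4 lattice and equal to the NONCONSTANT rational Jacobi-inversion function `x₁ + x₂`).
`quintic`, `curveV` are copied VERBATIM from `Cruxes/PeriodConjectureCurveType/SketchIdeator1.lean`.
Repair: add "`f` squarefree" (or type the full plane model `{y² = f(x)}`, whose smoothness forces it).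
-/

noncomputable section

open MvPolynomial Set Filter Topology
open Literature.NumberTheory.Transcendental Literature.NumberTheory.Transcendental.CurvePeriods

namespace TriageR1K2

/-- verbatim from `SketchIdeator1` -/
def quintic (lam : Fin 5 → ℂ) : MvPolynomial (Fin 3) ℂ :=
  C 4 * X 0 ^ 5 + ∑ i : Fin 5, C (lam i) * X 0 ^ (i : ℕ)

/-- verbatim from `SketchIdeator1` -/
abbrev curveV (lam : Fin 5 → ℂ) : CurveData := ⟨3, 2, ![X 1 ^ 2 - quintic lam, X 2 * X 1 - 1]⟩

theorem quintic_zero : quintic 0 = C 4 * X 0 ^ 5 := by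
  simp [quintic]

/-- Points of `V₀ = {y² = 4x⁵, w y = 1}`. -/
theorem mem_points_iff (p : Fin 3 → ℂ) :
    p ∈ (curveV 0).points ↔ p 1 ^ 2 = 4 * p 0 ^ 5 ∧ p 2 * p 1 = 1 := by
  rw [CurveData.mem_points]
  rw [show (∀ j : Fin (curveV 0).m, eval p ((curveV 0).F j) = 0) ↔
      eval p ((curveV 0).F 0) = 0 ∧ eval p ((curveV 0).F 1) = 0 from Fin.forall_fin_two]
  simp [quintic_zero, sub_eq_zero]

theorem p_one_ne_zero {p : Fin 3 → ℂ} (hp : p ∈ (curveV 0).points) : p 1 ≠ 0 := by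
  intro h
  rw [mem_points_iff] at hp
  have := hp.2
  rw [h, mul_zero] at this
  exact zero_ne_one this

/-- The `𝔾ₘ`-orbit through a point stays on `V₀`. -/
theorem orbit_mem {p : Fin 3 → ℂ} (hp : p ∈ (curveV 0).points) {s : ℂ} (hs : s ≠ 0) :
    (![s ^ 2 * p 0, s ^ 5 * p 1, (s ^ 5)⁻¹ * p 2] : Fin 3 → ℂ) ∈ (curveV 0).points := by
  rw [mem_points_iff] at hp ⊢
  obtain ⟨h1, h2⟩ := hp
  have h5 : s ^ 5 ≠ 0 := pow_ne_zero 5 hs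
  constructor
  · show (s ^ 5 * p 1) ^ 2 = 4 * (s ^ 2 * p 0) ^ 5
    calc (s ^ 5 * p 1) ^ 2 = s ^ 10 * p 1 ^ 2 := by ring
      _ = s ^ 10 * (4 * p 0 ^ 5) := by rw [h1]
      _ = 4 * (s ^ 2 * p 0) ^ 5 := by ring
  · show (s ^ 5)⁻¹ * p 2 * (s ^ 5 * p 1) = 1
    calc (s ^ 5)⁻¹ * p 2 * (s ^ 5 * p 1) = ((s ^ 5)⁻¹ * s ^ 5) * (p 2 * p 1) := by ring
      _ = 1 := by rw [inv_mul_cancel₀ h5, h2, one_mul]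

/-- Gradient components used in the rank computation. -/
theorem gradient_zero_one (p : Fin 3 → ℂ) : (curveV 0).gradient 0 p 1 = 2 * p 1 := by
  simp [CurveData.gradient, quintic_zero, Derivation.leibniz, Derivation.leibniz_pow, pderiv_X]

theorem gradient_zero_two (p : Fin 3 → ℂ) : (curveV 0).gradient 0 p 2 = 0 := by
  simp [CurveData.gradient, quintic_zero, Derivation.leibniz, Derivation.leibniz_pow, pderiv_X]

theorem gradient_one_one (p : Fin 3 → ℂ) : (curveV 0).gradient 1 p 1 = p 2 := by
  simp [CurveData.gradient, Derivation.leibniz, pderiv_X]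

theorem gradient_one_two (p : Fin 3 → ℂ) : (curveV 0).gradient 1 p 2 = p 1 := by
  simp [CurveData.gradient, Derivation.leibniz, pderiv_X]

/-- **`V₀ = curveV 0` IS a smooth affine curve over `ℚ̄`** in the sense of `CurvePeriods.lean`,
although `f = 4x⁵` is as non-squarefree as possible: the hypothesis of `kleinianSigma_genusTwo`
does not exclude the degenerate (genus-0) parameters. -/
theorem curveV_zero_smooth : (curveV 0).IsSmoothAffineCurve where
  algebraic j := by
    fin_cases j
    · have hq : HasAlgCoeffs (quintic 0) := by
        rw [quintic_zero]
        exact (hasAlgCoeffs_C (by exact_mod_cast isAlgebraic_algebraMap (4 : ℚ))).mul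
          ((hasAlgCoeffs_X (n := 3) 0).pow 5)
      simpa using ((hasAlgCoeffs_X (n := 3) 1).pow 2).sub hq
    · simpa using ((hasAlgCoeffs_X (n := 3) 2).mul (hasAlgCoeffs_X 1)).sub hasAlgCoeffs_one
  rank_eq p hp := by
    have hp1 : p 1 ≠ 0 := p_one_ne_zero hp
    have hli : LinearIndependent ℂ (fun j : Fin (curveV 0).m => (curveV 0).gradient j p) := by
      rw [Fintype.linearIndependent_iff]
      intro c hc j
      have e1 := congrFun hc 1
      have e2 := congrFun hc 2
      simp only [Finset.sum_apply, Pi.smul_apply, smul_eq_mul, Pi.zero_apply,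
        Fin.sum_univ_two] at e1 e2
      rw [show ((curveV 0).gradient 0 p 1) = 2 * p 1 from gradient_zero_one p,
        show ((curveV 0).gradient 1 p 1) = p 2 from gradient_one_one p] at e1
      rw [show ((curveV 0).gradient 0 p 2) = 0 from gradient_zero_two p,
        show ((curveV 0).gradient 1 p 2) = p 1 from gradient_one_two p] at e2
      -- e2 : c 0 * 0 + c 1 * p 1 = 0,  e1 : c 0 * (2 * p 1) + c 1 * p 2 = 0
      have hc1 : c 1 = 0 := by
        rw [mul_zero, zero_add] at e2
        exact (mul_eq_zero.mp e2).resolve_right hp1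
      have hc0 : c 0 = 0 := by
        rw [hc1, zero_mul, add_zero] at e1
        exact (mul_eq_zero.mp e1).resolve_right (mul_ne_zero two_ne_zero hp1)
      fin_cases j
      · exact hc0
      · exact hc1
    rw [finrank_span_eq_card hli]
    rfl
  not_isolated p hp := by
    have hp1 : p 1 ≠ 0 := p_one_ne_zero hp
    -- the real one-parameter orbit through `p`
    set orb : ℝ → (Fin 3 → ℂ) :=
      fun s => ![((s : ℂ)) ^ 2 * p 0, ((s : ℂ)) ^ 5 * p 1, (((s : ℂ)) ^ 5)⁻¹ * p 2] with horb
    have h1 : orb 1 = p := by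
      funext k
      fin_cases k <;> simp [horb]
    have hca : ContinuousAt orb 1 := by
      refine continuousAt_pi.2 fun k => ?_
      fin_cases k
      · show ContinuousAt (fun s : ℝ => ((s : ℂ)) ^ 2 * p 0) 1
        fun_prop
      · show ContinuousAt (fun s : ℝ => ((s : ℂ)) ^ 5 * p 1) 1
        fun_prop
      · show ContinuousAt (fun s : ℝ => (((s : ℂ)) ^ 5)⁻¹ * p 2) 1
        exact ((Complex.continuous_ofReal.continuousAt.pow 5).inv₀ (by norm_num)).mul
          continuousAt_const
    have htend : Tendsto orb (𝓝[≠] (1 : ℝ)) (𝓝 p) := by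
      have := hca.tendsto
      rw [h1] at this
      exact this.mono_left nhdsWithin_le_nhds
    refine mem_closure_of_tendsto htend ?_
    have hne0 : ∀ᶠ s : ℝ in 𝓝 (1 : ℝ), s ≠ 0 := eventually_ne_nhds one_ne_zero
    filter_upwards [mem_nhdsWithin_of_mem_nhds hne0, self_mem_nhdsWithin] with s hs0 hs1
    refine ⟨orbit_mem hp (by exact_mod_cast hs0), fun h => hs1 ?_⟩
    -- `orb s = p` forces `s⁵ = 1`, hence `s = 1` (real, odd exponent)
    have h' : ((s : ℂ)) ^ 5 * p 1 = p 1 := by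
      have := congrFun h 1
      simpa [horb] using this
    have hs5 : ((s : ℂ)) ^ 5 = 1 := by
      have : (((s : ℂ)) ^ 5 - 1) * p 1 = 0 := by rw [sub_mul, one_mul, h', sub_self]
      have := (mul_eq_zero.mp this).resolve_right hp1
      exact sub_eq_zero.mp this
    have hs5' : s ^ 5 = 1 := by exact_mod_cast hs5
    have h15 : s ^ 5 = (1 : ℝ) ^ 5 := by rw [hs5', one_pow]
    exact (Odd.strictMono_pow (by decide : Odd 5)).injective h15

/-- The orbit parametrisation also shows the curve is ONE rational orbit: `(1, 2, 1/2) ∈ V₀` and every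
point is `(s², 2s⁵, (2s⁵)⁻¹)` for `s = y/(2x²)` (recorded informally; `du₁ = w dx = s⁻⁴ ds`,
`du₂ = x w dx = s⁻² ds` are exact on `𝔾ₘ`, so all closed-path periods vanish — job j011936). -/
example : (![1, 2, 2⁻¹] : Fin 3 → ℂ) ∈ (curveV 0).points := by
  rw [mem_points_iff]
  refine ⟨?_, ?_⟩
  · show (2 : ℂ) ^ 2 = 4 * 1 ^ 5
    norm_num
  · show (2 : ℂ)⁻¹ * 2 = 1
    norm_num

end TriageR1K2

end
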